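import Summits.ABC.IUTFork.Repair.RHCellWeightsBed
import Summits.ABC.IUTFork.Repair.RHSigmaBudgetBridge
import HarnessLib

/-!
# R-H ROUND 2, Q1′ (i) «MINIMUM Σ»: the per-cell weight `c(w,j)` in LOCAL-DEGREE and DICTIONARY currency, the PER-CELL trivial bound
# `−σ_{i+1,v_ℚ} = cellDeficit ≤ t(i,v_ℚ)`, and the off-window deficit socket of p467532 closed with `B := gap − mass(Σ)`

abc-iut cell, rung LADDER-ABC:A2.RESCUE.H; R-H ROUND 2 seat abc-iut-rh2-w-2 (Q1′ WEIGHTS typer 2/2, gen 2; director-abc g3 22:18Z «extract c(w,j) from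
the typed chain (start at `Repair/RHSlotReachSigmaBudget` p467532 σ-summands)»). PROOF-ONLY file (0 definitions, 0 `Prop` facts), companion of
abc-iut-rh2-w-1's `Repair/RHCellWeights{,Bed}.lean` (p476759 / p477159: weight `t(i,v_ℚ) := ((i+1)²−1)·(−qLocal_{i+1,v_ℚ})`, per-place split in the
`P_q(v)·log N(v)/[F:ℚ]` shape, knapsack `offRemainder P Σ ≤ gap − mass(Σ)`), of abc-iut-rh2-q2-eq's `RHSigmaStrataEqPilotGap` (p472500) and of
abc-iut-rh-typ-12's window budget `RHSigmaBudget` / bridge `RHSigmaBudgetBridge` (p467532 / p469317). WHAT IS ADDED: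
* §1 **LOCAL-DEGREE CURRENCY** (`plan/rescue/R-H/MIN-SLICE.md` §(i) line «`c(w,j) := (1/l⋆)·(n_w/[K:ℚ])·(log p_w)/e_w`» VERBATIM): per place
  `P_q(v)·log N(v) = n_v·(P_q(v)/e_v)·log p_v` (`qPilot_mul_logNorm_eq_localDegree`; `log N(v) = f_v·log p_v`, `n_v = e_v·f_v`), hence at the genuine bed
  `t(i,p) = ((i+1)²−1)·Σ_{v|p} (n_v/[F:ℚ])·(P_q(v)/e_v)·log p` (`pilotGapWeight_inr_eq_sum_localDegree`): the cell `(w,j)` weighs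
  `l⋆·c(w,j) = (n_w/[F:ℚ])·(log p/e_w)` per unit of its demand `d(w,j) = (j²−1)·m_q(w)`, `m_q(w) = P_q(w)`;
* §2 **DICTIONARY CURRENCY** — the SAME number in the binders of the row-15/8/16/18 doors (p467532's `e`, `mq` with `hϖ`/`hq`; at the genuine bed
  `e = ramIdx`, `(mq w : ℝ) = P_q(w)` — `RH2SigmaHull.norm_qIdele_eq_zpow_of_realises`' `hmq`): `t(i,p) = ((i+1)²−1)·Σ_{w ∈ Fibre(p), w bad}
  (n_w/[F:ℚ])·(m_q(w)/e_w)·log p` (`pilotGapWeight_inr_eq_sum_dictionary`) — the R-W WINDOW-TABLE integers (cols `e_w`, `m_q`) ARE the weight's inputs;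
* §3 **PER CELL, NOT SUMMED**: at the bed with realising ideles, `cellDeficit_{i,v_ℚ} ≤ t(i,v_ℚ)` (`cellDeficit_le_pilotGapWeight`; q2-eq's
  `offRemainder_le_offPilotGap` is its `PN Σᶠ (·)⁺`-sum) and, in p467532's vocabulary, the σ-summand `logvol(ⁿ˒°𝒰_{i+1,v_ℚ}) − qLocal_{i+1,v_ℚ} = −cellDeficit
  ≥ −t(i,v_ℚ)` (`sigmaSummand_eq_neg_cellDeficit`, `neg_pilotGapWeight_le_sigmaSummand`) — MIN-SLICE §(i) «NO licence ⟹ only the hull-free bound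
  σ(j,w) ≥ −t_triv(w,j)», cell by cell (the numerics' «0 cells with data cost > trivial cost», kit-2 PASS 18c (e), as a theorem);
* §4 **THE SOCKET OF p467532 CLOSED IN MASS CURRENCY**: `OffWindowDeficitLe ⟨situationPrVol, col⟩ (settingPrVolSharp …) Σ ((deĝ_lgp(P_Θ) − deĝ(P_q)) − mass(Σ))`
  for EVERY window `Σ` and ANY columns (`offWindowDeficitLe_pilotGap_sub_mass`; bridge `offWindowDeficitLe_offRemainder` + w-1's
  `offRemainder_le_pilotGap_sub_mass`) — so typ-12's `negLogQ_sub_le_negLogTheta_slotReach_of_offSigmaDeficitLe` (row 15; rows 8/16/18 through their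
  doors) reads, with realising ideles, «S|Σ₁₅ ⟹ −|log(q)| − (M − mass(Σ₁₅)) ≤ −|log(Θ)|», `M = T.gap` (w-1 `pilotGap_pilotDataOfK_eq`): the B of
  ROUND2 booking B1 «E_off = D_off(W_row(T))» bounded by the MIN-SLICE number `B_triv(Σᶜ) = M − mass(Σ)` BY NAME.
HONEST FRAMING: identities/inequalities about OUR typed quantities; nothing here asserts that abc is proved or refuted, or that [IUTchIII] Cor. 3.12
holds or fails at any datum, or takes a side on any author; typed ≠ proved; computed ≠ proved. [claim: Mochizuki2012, status: disputed] for every IUT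
locution. [cite: Mochizuki2012, IUTchIII Cor. 3.12 p. 173–174, Prop. 3.9 (i)–(iii) p. 116–117; IUTchIV Def. 1.9 (i) p. 22, Prop. 1.7 p. 16–17, Thm. 1.10
Step (v) p. 27–28] [cite: DupuyHilado2025, §2.5.4, §3.3, §3.6, §3.9, Thm. 3.10.1]
-/

noncomputable section

open Set Function NumberField IsDedekindDomain
open scoped Pointwise

namespace Summit.ABC.IUTFork.Repair.RH.CellWeights

open Summit.ABC.IUTFork.Thm311 Summit.ABC.IUTFork.Thm311.Real Summit.ABC.IUTFork.Cor312 Summit.ABC.IUTFork.Cor312.Setting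
  Summit.ABC.IUTFork.Cor312Vol Summit.ABC.IUTFork.Cor312Prov Literature.IUT.LogThetaLattice Literature.IUT.LogVolume
  Literature.IUT.HodgeTheaters Literature.IUT.LogVolume.ThetaData
  Summit.ABC.IUTFork.Repair.RH.SigmaLicence Summit.ABC.IUTFork.Repair.RH.SigmaStrataEq

/-! ## §1. Local-degree currency: `P_q(v)·log N(v) = n_v·(P_q(v)/e_v)·log p_v` -/

section LocalDegree

variable {F : Type} [Field F] [NumberField F] (X : PilotData F)

/-- **Per place: `P_q(v)·log N(v) = n_v·(P_q(v)/e_v)·log p_v`** (`log N(v) = f_v·log p_v`, `n_v = e_v·f_v`, Dupuy–Hilado §2.5.4/§3.6) — the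
`v`-summand of the pilot-gap weight in MIN-SLICE §(i)'s currency: local degree over `[F:ℚ]` (outside), `e_v`-normalised order `P_q(v)/e_v = m_q(v)/e_v`,
`log p`. [cite: DupuyHilado2025, §2.5.4, §3.6] -/
theorem qPilot_mul_logNorm_eq_localDegree (v : HeightOneSpectrum (𝓞 F)) :
    X.qPilot v * logNorm F v = (localDegree F v : ℝ) * (X.qPilot v / ramIdx F v) * Real.log (residueChar F v) := by
  rw [logNorm_eq, localDegree]
  push_cast
  have he : (ramIdx F v : ℝ) ≠ 0 := by exact_mod_cast ramIdx_ne_zero F v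
  field_simp

/-- Over one rational prime `p` every place has residue characteristic `p`: `Σ_{v|p} P_q(v)·log N(v) = Σ_{v|p} n_v·(P_q(v)/e_v)·log p`.
[cite: DupuyHilado2025, §2.5.4, §3.6] -/
theorem sum_placesOver_qPilot_mul_logNorm (pp : Nat.Primes) :
    ∑ v ∈ placesOver F pp, X.qPilot v * logNorm F v =
      ∑ v ∈ placesOver F pp, (localDegree F v : ℝ) * (X.qPilot v / ramIdx F v) * Real.log (pp : ℕ) := by
  haveI : Fact (pp : ℕ).Prime := ⟨pp.2⟩
  refine Finset.sum_congr rfl fun v hv => ?_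
  rw [qPilot_mul_logNorm_eq_localDegree, (mem_placesOver_iff_residueChar v).mp hv]

end LocalDegree

/-! ## §2–§4. At the genuine bed `settingPrVolSharp X` -/

section Bed

variable {F : Type} [Field F] [NumberField F] (X : PilotData F) {logv : PadicLogs F} (hlog : LogvAnalytic logv)
  (M : Type) [Field M] [NumberField M]
  (archPk : ∀ (j : (thetaIndex X).Label) (vQ : (thetaIndex X).VQ), Set ((logShellsDH X logv).Packet j vQ))
  (archSub : ∀ (j : (thetaIndex X).Label) (v : (thetaIndex X).V),
    Set ((logShellsDH X logv).Packet j ((thetaIndex X).over v)))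
  (Ψ : ℤ → ∀ v : (thetaIndex X).V, v ∈ (thetaIndex X).Vbad → Set ((logShellsDH X logv).StarPacket v))
  (act : ℤ → ∀ v : (thetaIndex X).V, v ∈ (thetaIndex X).Vbad →
    (logShellsDH X logv).StarPacket v → Module.End ℚ ((logShellsDH X logv).StarPacket v))
  (Mmod : ℤ → ∀ j : (thetaIndex X).LabelStar, Set ((logShellsDH X logv).GlobalPacket j.1))
  (region : ℤ → ∀ j : (thetaIndex X).LabelStar, FinDivisor M → ∀ vQ : (thetaIndex X).VQ,
    Set ((logShellsDH X logv).Packet j.1 vQ))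
  (n : ℤ) {HT : Type} {LogLink : HT → HT → Type} {IsFull : ∀ {s t : HT}, LogLink s t → Prop}
  (lat : LGPGaussianLogThetaLattice LogLink IsFull)
  {Frd : Type} {IsoF : Frd → Frd → Type} {Ob : Frd → Type} {realify : Frd → Frd} {Strip : Type}
  {IsoS : Strip → Strip → Type} {Mv : ∀ v : (thetaIndex X).V, v ∈ (thetaIndex X).Vbad → Type}
  [∀ v h, Monoid (Mv v h)]
  (sig : GlobalLGPFrobenioidSignature (thetaIndex X).lstar (thetaIndex X).V (· ∈ (thetaIndex X).Vbad)
    Frd IsoF Ob realify Strip IsoS Mv)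
  (split : SplittingMonoids Mv) {ObΔ : Type} {N : ∀ v : (thetaIndex X).V, v ∈ (thetaIndex X).Vbad → Type}
  [∀ v h, Monoid (N v h)] (qData : QPilotData ObΔ N)
  (tq : ∀ (pp : Nat.Primes) (x : (thetaIndex X).Fibre (.inr pp)), haveI : Fact (pp : ℕ).Prime := ⟨pp.2⟩; kOf X pp.1 x)
  (t : ∀ (pp : Nat.Primes) (_ : Fin X.lstar) (x : (thetaIndex X).Fibre (.inr pp)),
    haveI : Fact (pp : ℕ).Prime := ⟨pp.2⟩; kOf X pp.1 x)
  (htq0 : ∀ pp x, tq pp x ≠ 0)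
  (htq1 : ∀ (pp : Nat.Primes) (x : (thetaIndex X).Fibre (.inr pp)),
    haveI : Fact (pp : ℕ).Prime := ⟨pp.2⟩; placeOf X pp.1 x ∉ X.S → ‖tq pp x‖ = 1)

/-! ### §2. The weight in local-degree and in dictionary currency -/

/-- **THE WEIGHT IN LOCAL-DEGREE CURRENCY** (q-ideles realising `P_q`): at the prime cell `(i+1, p)`,
`t(i,p) = ((i+1)²−1)·Σ_{v|p} (n_v/[F:ℚ])·(P_q(v)/e_v)·log p` — MIN-SLICE §(i): the cell `(w, j)` over `p` carries the weight
`l⋆·c(w,j) = (n_w/[F:ℚ])·(log p_w/e_w)` per unit of its demand `d(w,j) = (j²−1)·m_q(w)`, `m_q(w) = P_q(w)` ([IUTchIV] Def. 1.9 (i): normalised degree;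
Prop. 1.7: tuple weights collapse to single-place weighted averages). abc-iut-rh2-w-1's `pilotGapWeight_inr_eq_sum_placesOver` rewritten by §1.
[cite: Mochizuki2012, IUTchIV Def. 1.9 (i) p. 22, Prop. 1.7 p. 16–17] [cite: DupuyHilado2025, §3.6, Thm. 3.10.1] [claim: Mochizuki2012, status: disputed] -/
theorem pilotGapWeight_inr_eq_sum_localDegree
    (htq : ∀ (pp : Nat.Primes) (x : (thetaIndex X).Fibre (.inr pp)),
      haveI : Fact (pp : ℕ).Prime := ⟨pp.2⟩
      Real.log ‖tq pp x‖ = -(X.qPilot (placeOf X pp.1 x)) * logNorm F (placeOf X pp.1 x) / localDegree F (placeOf X pp.1 x))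
    (i : Fin (thetaIndex X).lstar) (pp : Nat.Primes) :
    ((((i : ℕ) : ℝ) + 1) ^ 2 - 1) *
        (-(settingPrVolSharp X hlog M archPk archSub Ψ act Mmod region n lat sig split qData tq t htq0 htq1).qLocal
          (labelSucc i) (.inr pp)) =
      ((((i : ℕ) : ℝ) + 1) ^ 2 - 1) *
        ∑ v ∈ placesOver F pp, (localDegree F v : ℝ) / Module.finrank ℚ F * (X.qPilot v / ramIdx F v) * Real.log (pp : ℕ) := by
  rw [pilotGapWeight_inr_eq_sum_placesOver X hlog M archPk archSub Ψ act Mmod region n lat sig split qData tq t htq0 htq1 htq i pp,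
    sum_placesOver_qPilot_mul_logNorm, Finset.sum_div]
  congr 1
  exact Finset.sum_congr rfl fun v _ => by ring

open scoped Classical in
/-- **THE WEIGHT IN DICTIONARY CURRENCY** — the integers of the row-15/8/16/18 doors' binders (`RHSlotReachSigmaBudget` p467532: `e`, `mq` with
`‖ϖ_w‖ = p^{−1/e_w}`, `‖t_{q,w}‖ = ‖ϖ_w‖^{m_q(w)}`; at the genuine bed `e_w = ramIdx` and `(m_q(w) : ℝ) = P_q(w)` — the `hmq` of
`RH2SigmaHull.norm_qIdele_eq_zpow_of_realises`): `t(i,p) = ((i+1)²−1)·Σ_{w ∈ Fibre(p), w bad} (n_w/[F:ℚ])·(m_q(w)/e_w)·log p`. The R-W WINDOW-TABLE's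
integer columns `e_w`, `m_q` are the inputs of the weight; good places contribute `0`. [cite: DupuyHilado2025, §3.4, §3.6]
[cite: Mochizuki2012, IUTchIV Thm. 1.10 Step (v) p. 27–28] [claim: Mochizuki2012, status: disputed] -/
theorem pilotGapWeight_inr_eq_sum_dictionary
    (htq : ∀ (pp : Nat.Primes) (x : (thetaIndex X).Fibre (.inr pp)),
      haveI : Fact (pp : ℕ).Prime := ⟨pp.2⟩
      Real.log ‖tq pp x‖ = -(X.qPilot (placeOf X pp.1 x)) * logNorm F (placeOf X pp.1 x) / localDegree F (placeOf X pp.1 x))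
    (e : ∀ pp : Nat.Primes, (thetaIndex X).Fibre (.inr pp) → ℕ)
    (he : ∀ (pp : Nat.Primes) (x : (thetaIndex X).Fibre (.inr pp)), haveI : Fact (pp : ℕ).Prime := ⟨pp.2⟩
      e pp x = ramIdx F (placeOf X pp.1 x))
    (mq : ∀ pp : Nat.Primes, (thetaIndex X).Fibre (.inr pp) → ℤ)
    (hmq : ∀ (pp : Nat.Primes) (x : (thetaIndex X).Fibre (.inr pp)), haveI : Fact (pp : ℕ).Prime := ⟨pp.2⟩
      placeOf X pp.1 x ∈ X.S → (mq pp x : ℝ) = X.qPilot (placeOf X pp.1 x))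
    (i : Fin (thetaIndex X).lstar) (pp : Nat.Primes) :
    haveI : Fact (pp : ℕ).Prime := ⟨pp.2⟩
    -- the fibre over `p` is finite: it IS `V(F)_p` (`fibreEquivPlacesOver`)
    haveI : Fintype ((thetaIndex X).Fibre (.inr pp)) := Fintype.ofEquiv _ (fibreEquivPlacesOver X pp).symm
    ((((i : ℕ) : ℝ) + 1) ^ 2 - 1) *
        (-(settingPrVolSharp X hlog M archPk archSub Ψ act Mmod region n lat sig split qData tq t htq0 htq1).qLocal
          (labelSucc i) (.inr pp)) =
      ((((i : ℕ) : ℝ) + 1) ^ 2 - 1) *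
        ∑ x : (thetaIndex X).Fibre (.inr pp),
          if placeOf X pp.1 x ∈ X.S then
            (localDegree F (placeOf X pp.1 x) : ℝ) / Module.finrank ℚ F * ((mq pp x : ℝ) / (e pp x : ℝ)) * Real.log (pp : ℕ)
          else 0 := by
  haveI : Fact (pp : ℕ).Prime := ⟨pp.2⟩
  letI : Fintype ((thetaIndex X).Fibre (.inr pp)) := Fintype.ofEquiv _ (fibreEquivPlacesOver X pp).symm
  rw [pilotGapWeight_inr_eq_sum_localDegree X hlog M archPk archSub Ψ act Mmod region n lat sig split qData tq t htq0 htq1 htq i pp]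
  congr 1
  rw [← Finset.sum_coe_sort (placesOver F pp)]
  refine (Fintype.sum_equiv (fibreEquivPlacesOver X pp) _ _ fun x => ?_).symm
  change (if placeOf X pp.1 x ∈ X.S then
      (localDegree F (placeOf X pp.1 x) : ℝ) / Module.finrank ℚ F * ((mq pp x : ℝ) / (e pp x : ℝ)) * Real.log (pp : ℕ) else 0) =
    (localDegree F (placeOf X pp.1 x) : ℝ) / Module.finrank ℚ F * (X.qPilot (placeOf X pp.1 x) / ramIdx F (placeOf X pp.1 x)) *
      Real.log (pp : ℕ)
  split_ifs with hS
  · rw [hmq pp x hS, he pp x]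
  · rw [X.qPilot_apply_of_not_mem hS, zero_div, mul_zero, zero_mul]

/-! ### §3. Per cell: the deficit is at most the weight; p467532's σ-summand is at least `−t` -/

/-- **PER CELL, the deficit is at most the weight** (Θ- and q-ideles REALISING, non-zero, units off `S`): `cellDeficit_{i,v_ℚ} ≤ t(i,v_ℚ) =
((i+1)²−1)·(−qLocal_{i+1,v_ℚ})` — the hull contains the (Ind3)-enlarged Θ-region (`cellDeficit_le_qLocal_sub_image`), whose image gap is `t` in
closed form (abc-iut-rh2-q2-eq `imageGap_thetaRegion3_inr/_inl`). The cell-level form of `offRemainder_le_offPilotGap` (p472500) — MIN-SLICE §(i):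
«no licence at `(w,j)` ⟹ only the hull-free bound `σ ≥ −t_triv`», i.e. data cost ≤ trivial cost at EVERY cell. [cite: DupuyHilado2025, §3.3, §3.9, Thm. 3.10.1]
[claim: Mochizuki2012, status: disputed] -/
theorem cellDeficit_le_pilotGapWeight (ht0 : ∀ pp i x, t pp i x ≠ 0)
    (ht1 : ∀ (pp : Nat.Primes) (i : Fin X.lstar) (x : (thetaIndex X).Fibre (.inr pp)),
      haveI : Fact (pp : ℕ).Prime := ⟨pp.2⟩; placeOf X pp.1 x ∉ X.S → ‖t pp i x‖ = 1)
    (ht : ∀ (pp : Nat.Primes) (i : Fin X.lstar) (x : (thetaIndex X).Fibre (.inr pp)),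
      haveI : Fact (pp : ℕ).Prime := ⟨pp.2⟩
      Real.log ‖t pp i x‖ = -(X.thetaPilot i (placeOf X pp.1 x)) * logNorm F (placeOf X pp.1 x) / localDegree F (placeOf X pp.1 x))
    (htq : ∀ (pp : Nat.Primes) (x : (thetaIndex X).Fibre (.inr pp)),
      haveI : Fact (pp : ℕ).Prime := ⟨pp.2⟩
      Real.log ‖tq pp x‖ = -(X.qPilot (placeOf X pp.1 x)) * logNorm F (placeOf X pp.1 x) / localDegree F (placeOf X pp.1 x))
    (i : Fin (thetaIndex X).lstar) (vQ : (thetaIndex X).VQ) :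
    cellDeficit (settingPrVolSharp X hlog M archPk archSub Ψ act Mmod region n lat sig split qData tq t htq0 htq1) i vQ ≤
      ((((i : ℕ) : ℝ) + 1) ^ 2 - 1) *
        (-(settingPrVolSharp X hlog M archPk archSub Ψ act Mmod region n lat sig split qData tq t htq0 htq1).qLocal (labelSucc i) vQ) := by
  -- the global choice of possible images `U_Θ :=` the (Ind3)-enlarged Θ-pilot regions (as in p472500)
  let UΘ : ImageChoice (settingPrVolSharp X hlog M archPk archSub Ψ act Mmod region n lat sig split qData tq t htq0 htq1) :=
    ⟨fun c => (settingPrVolSharp X hlog M archPk archSub Ψ act Mmod region n lat sig split qData tq t htq0 htq1).thetaRegion3 _ c.2,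
      fun c => (settingPrVolSharp X hlog M archPk archSub Ψ act Mmod region n lat sig split qData tq t htq0 htq1).thetaRegion3_mem_possibleImages
        _ c.2⟩
  have H := bridgeHyps_settingPrVolSharp_of_ideles X hlog M archPk archSub Ψ act Mmod region n lat sig split qData t tq ht0 ht1 htq0 htq1
  refine (cellDeficit_le_qLocal_sub_image H UΘ i vQ).trans ((le_max_left _ 0).trans_eq ?_)
  cases vQ with
  | inl u =>
    rw [CandExplicit30Real.qLocal_settingPrVolSharp_inl X hlog M archPk archSub Ψ act Mmod region n lat sig split qData (t := t) (tq := tq) htq0 htq1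
      (labelSucc i) u, neg_zero, mul_zero]
    have h := imageGap_thetaRegion3_inl X hlog M archPk archSub Ψ act Mmod region n lat sig split qData tq t htq0 htq1 i u
    rw [CandExplicit30Real.qLocal_settingPrVolSharp_inl X hlog M archPk archSub Ψ act Mmod region n lat sig split qData (t := t) (tq := tq) htq0 htq1
      (labelSucc i) u] at h
    exact h
  | inr pp =>
    exact imageGap_thetaRegion3_inr X hlog M archPk archSub Ψ act Mmod region n lat sig split qData tq t htq0 htq1 ht0 ht htq i pp

/-- **p467532's σ-summand is minus the deficit**: `logvol(ⁿ˒°𝒰_{i+1,v_ℚ}) − qLocal_{i+1,v_ℚ} = −cellDeficit_{i,v_ℚ}` — the summand of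
abc-iut-rh-typ-12's off-window term `PN(i ↦ Σᶠ_{(i,v_ℚ) ∉ Σ} σ)` (`RHSlotReachSigmaBudget.negLogQ_add_offSigma_le_negLogTheta_slotReach`) and of
abc-iut-rh2-q2-eq's `offRemainder` are one cell quantity up to sign / positive part (the bridge p469317 at the level of sums). [folklore] -/
theorem sigmaSummand_eq_neg_cellDeficit {T : ThetaIndex} {S : Situation T} (P : Cor312.Setting S) (i : Fin T.lstar) (vQ : T.VQ) :
    (S.D P.n).logvol (labelSucc i) vQ (P.thetaHull (labelSucc i) vQ) - P.qLocal (labelSucc i) vQ = -cellDeficit P i vQ := by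
  unfold cellDeficit
  ring

/-- **PER CELL, p467532's σ-summand is at least `−t(i,v_ℚ)`** at the bed with realising ideles: `−((i+1)²−1)·(−qLocal_{i+1,v_ℚ}) ≤
logvol(ⁿ˒°𝒰_{i+1,v_ℚ}) − qLocal_{i+1,v_ℚ}` — MIN-SLICE §(i) «σ(j,w) ≥ −t_triv(w,j)» summed over the places `w | v_ℚ` of the cell, the weight read in
§1/§2's currencies. [cite: Mochizuki2012, IUTchIII Cor. 3.12 p. 173–174] [cite: DupuyHilado2025, §3.3, Thm. 3.10.1] [claim: Mochizuki2012, status: disputed] -/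
theorem neg_pilotGapWeight_le_sigmaSummand (ht0 : ∀ pp i x, t pp i x ≠ 0)
    (ht1 : ∀ (pp : Nat.Primes) (i : Fin X.lstar) (x : (thetaIndex X).Fibre (.inr pp)),
      haveI : Fact (pp : ℕ).Prime := ⟨pp.2⟩; placeOf X pp.1 x ∉ X.S → ‖t pp i x‖ = 1)
    (ht : ∀ (pp : Nat.Primes) (i : Fin X.lstar) (x : (thetaIndex X).Fibre (.inr pp)),
      haveI : Fact (pp : ℕ).Prime := ⟨pp.2⟩
      Real.log ‖t pp i x‖ = -(X.thetaPilot i (placeOf X pp.1 x)) * logNorm F (placeOf X pp.1 x) / localDegree F (placeOf X pp.1 x))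
    (htq : ∀ (pp : Nat.Primes) (x : (thetaIndex X).Fibre (.inr pp)),
      haveI : Fact (pp : ℕ).Prime := ⟨pp.2⟩
      Real.log ‖tq pp x‖ = -(X.qPilot (placeOf X pp.1 x)) * logNorm F (placeOf X pp.1 x) / localDegree F (placeOf X pp.1 x))
    (i : Fin (thetaIndex X).lstar) (vQ : (thetaIndex X).VQ) :
    -(((((i : ℕ) : ℝ) + 1) ^ 2 - 1) *
        (-(settingPrVolSharp X hlog M archPk archSub Ψ act Mmod region n lat sig split qData tq t htq0 htq1).qLocal (labelSucc i) vQ)) ≤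
      ((situationPrVol X hlog M archPk archSub Ψ act Mmod region).D n).logvol (labelSucc i) vQ
          ((settingPrVolSharp X hlog M archPk archSub Ψ act Mmod region n lat sig split qData tq t htq0 htq1).thetaHull (labelSucc i) vQ) -
        (settingPrVolSharp X hlog M archPk archSub Ψ act Mmod region n lat sig split qData tq t htq0 htq1).qLocal (labelSucc i) vQ := by
  have h := cellDeficit_le_pilotGapWeight X hlog M archPk archSub Ψ act Mmod region n lat sig split qData tq t htq0 htq1 ht0 ht1 ht htq i vQ
  -- `cellDeficit` unfolded, with the setting's column index `P.n = n` (definitional)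
  have h2 : (settingPrVolSharp X hlog M archPk archSub Ψ act Mmod region n lat sig split qData tq t htq0 htq1).qLocal (labelSucc i) vQ -
      ((situationPrVol X hlog M archPk archSub Ψ act Mmod region).D n).logvol (labelSucc i) vQ
        ((settingPrVolSharp X hlog M archPk archSub Ψ act Mmod region n lat sig split qData tq t htq0 htq1).thetaHull (labelSucc i) vQ) ≤
      ((((i : ℕ) : ℝ) + 1) ^ 2 - 1) *
        (-(settingPrVolSharp X hlog M archPk archSub Ψ act Mmod region n lat sig split qData tq t htq0 htq1).qLocal (labelSucc i) vQ) := h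
  linarith

/-! ### §4. The off-window deficit socket of p467532, closed in mass currency -/

/-- **THE D_off SOCKET OF p467532 IN MASS CURRENCY.** At the bed with REALISING ideles, for EVERY window `Σ ⊆ 𝔽_l^⋇ × V_ℚ` and ANY columns
`col`: `OffWindowDeficitLe ⟨situationPrVol, col⟩ (settingPrVolSharp …) Σ ((deĝ_lgp(P_Θ) − deĝ(P_q)) − mass(Σ))`, `mass(Σ) = PN(i ↦ Σᶠ_{v_ℚ}
1_Σ(i,v_ℚ)·t(i,v_ℚ))` — abc-iut-rh-typ-12's bridge `offWindowDeficitLe_offRemainder` (p469317: `D_off(Σ) ≤ R_Σ`) + abc-iut-rh2-w-1's knapsack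
`offRemainder_le_pilotGap_sub_mass` (p477159). Plugged into `RHSlotReachSigmaBudget.negLogQ_sub_le_negLogTheta_slotReach_of_offSigmaDeficitLe`
(`Σ := Σ₁₅`; rows 8/16/18 via their doors) as its `hB`: «S|Σ ⟹ −|log(q)| − (M − mass(Σ)) ≤ −|log(Θ)|» with `M = deĝ_lgp(P_Θ) − deĝ(P_q)`
(`= ((l+1)/24 − 1/(2l))·log(q) = T.gap` at `pilotDataOfK D K`, w-1 `pilotGap_pilotDataOfK_eq`) — ROUND2 B1's «E_off = D_off(W_row(T))» bounded by
MIN-SLICE's `B_triv(Σᶜ) = M − mass(Σ)` BY NAME. [cite: Mochizuki2012, IUTchIII Cor. 3.12 p. 173–174] [cite: DupuyHilado2025, §3.3, Thm. 3.10.1]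
[claim: Mochizuki2012, status: disputed] -/
theorem offWindowDeficitLe_pilotGap_sub_mass (ht0 : ∀ pp i x, t pp i x ≠ 0)
    (ht1 : ∀ (pp : Nat.Primes) (i : Fin X.lstar) (x : (thetaIndex X).Fibre (.inr pp)),
      haveI : Fact (pp : ℕ).Prime := ⟨pp.2⟩; placeOf X pp.1 x ∉ X.S → ‖t pp i x‖ = 1)
    (ht : ∀ (pp : Nat.Primes) (i : Fin X.lstar) (x : (thetaIndex X).Fibre (.inr pp)),
      haveI : Fact (pp : ℕ).Prime := ⟨pp.2⟩
      Real.log ‖t pp i x‖ = -(X.thetaPilot i (placeOf X pp.1 x)) * logNorm F (placeOf X pp.1 x) / localDegree F (placeOf X pp.1 x))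
    (htq : ∀ (pp : Nat.Primes) (x : (thetaIndex X).Fibre (.inr pp)),
      haveI : Fact (pp : ℕ).Prime := ⟨pp.2⟩
      Real.log ‖tq pp x‖ = -(X.qPilot (placeOf X pp.1 x)) * logNorm F (placeOf X pp.1 x) / localDegree F (placeOf X pp.1 x))
    (col : ℤ → Column (logShellsDH X logv)) (σ : Set (Fin (thetaIndex X).lstar × (thetaIndex X).VQ)) :
    RHSlotReach.OffWindowDeficitLe
      ({ toSituation := situationPrVol X hlog M archPk archSub Ψ act Mmod region, col := col } : LatticeSituation (thetaIndex X))
      (settingPrVolSharp X hlog M archPk archSub Ψ act Mmod region n lat sig split qData tq t htq0 htq1) σ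
      ((LgpDivisor.ndegLgp X.thetaPilot - FinDivisor.ndeg F X.qPilot) -
        processionNormalized (fun i : Fin (thetaIndex X).lstar => ∑ᶠ vQ : (thetaIndex X).VQ,
          σ.indicator (fun c : Fin (thetaIndex X).lstar × (thetaIndex X).VQ => ((((c.1 : ℕ) : ℝ) + 1) ^ 2 - 1) *
            (-(settingPrVolSharp X hlog M archPk archSub Ψ act Mmod region n lat sig split qData tq t htq0 htq1).qLocal
              (labelSucc c.1) c.2)) (i, vQ))) := by
  have HB := bridgeHyps_settingPrVolSharp_of_ideles X hlog M archPk archSub Ψ act Mmod region n lat sig split qData t tq ht0 ht1 htq0 htq1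
  have h1 := RHSlotReach.offWindowDeficitLe_offRemainder
    ({ toSituation := situationPrVol X hlog M archPk archSub Ψ act Mmod region, col := col } : LatticeSituation (thetaIndex X))
    (settingPrVolSharp X hlog M archPk archSub Ψ act Mmod region n lat sig split qData tq t htq0 htq1) σ HB
  have h2 := offRemainder_le_pilotGap_sub_mass X hlog M archPk archSub Ψ act Mmod region n lat sig split qData tq t htq0 htq1 ht0 ht1 ht htq σ
  unfold RHSlotReach.OffWindowDeficitLe at h1 ⊢
  linarith

/-- **… hence, in that socket, licence on `Σ` gives Cor. 3.12 up to `M − mass(Σ)`** (any columns): `−|log(q)| − (M − mass(Σ)) ≤ −|log(Θ)|` with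
`M = deĝ_lgp(P_Θ) − deĝ(P_q)` — typ-12's `negLogQ_sub_le_negLogTheta_of_licenceOn` (generic window budget, p467532's parent) with §4's `B`; the
licence hypothesis is the setting-level one (`qRegion ⊆ ⁿ˒°𝒰` on `Σ`), supplied at Σ₁₅/Σ₈/Σ₁₆/Σ₁₈ by the landed doors. [cite: Mochizuki2012, IUTchIII Cor. 3.12 p. 173–174]
[claim: Mochizuki2012, status: disputed] -/
theorem negLogQ_sub_pilotGapSubMass_le_negLogTheta_of_licenceOn (ht0 : ∀ pp i x, t pp i x ≠ 0)
    (ht1 : ∀ (pp : Nat.Primes) (i : Fin X.lstar) (x : (thetaIndex X).Fibre (.inr pp)),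
      haveI : Fact (pp : ℕ).Prime := ⟨pp.2⟩; placeOf X pp.1 x ∉ X.S → ‖t pp i x‖ = 1)
    (ht : ∀ (pp : Nat.Primes) (i : Fin X.lstar) (x : (thetaIndex X).Fibre (.inr pp)),
      haveI : Fact (pp : ℕ).Prime := ⟨pp.2⟩
      Real.log ‖t pp i x‖ = -(X.thetaPilot i (placeOf X pp.1 x)) * logNorm F (placeOf X pp.1 x) / localDegree F (placeOf X pp.1 x))
    (htq : ∀ (pp : Nat.Primes) (x : (thetaIndex X).Fibre (.inr pp)),
      haveI : Fact (pp : ℕ).Prime := ⟨pp.2⟩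
      Real.log ‖tq pp x‖ = -(X.qPilot (placeOf X pp.1 x)) * logNorm F (placeOf X pp.1 x) / localDegree F (placeOf X pp.1 x))
    (col : ℤ → Column (logShellsDH X logv)) (σ : Set (Fin (thetaIndex X).lstar × (thetaIndex X).VQ))
    (hon : ∀ (i : Fin (thetaIndex X).lstar) (vQ : (thetaIndex X).VQ), (i, vQ) ∈ σ →
      (settingPrVolSharp X hlog M archPk archSub Ψ act Mmod region n lat sig split qData tq t htq0 htq1).qRegion (labelSucc i) vQ ⊆
        (settingPrVolSharp X hlog M archPk archSub Ψ act Mmod region n lat sig split qData tq t htq0 htq1).thetaHull (labelSucc i) vQ) :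
    (((settingPrVolSharp X hlog M archPk archSub Ψ act Mmod region n lat sig split qData tq t htq0 htq1).negLogQ -
          ((LgpDivisor.ndegLgp X.thetaPilot - FinDivisor.ndeg F X.qPilot) -
            processionNormalized (fun i : Fin (thetaIndex X).lstar => ∑ᶠ vQ : (thetaIndex X).VQ,
              σ.indicator (fun c : Fin (thetaIndex X).lstar × (thetaIndex X).VQ => ((((c.1 : ℕ) : ℝ) + 1) ^ 2 - 1) *
                (-(settingPrVolSharp X hlog M archPk archSub Ψ act Mmod region n lat sig split qData tq t htq0 htq1).qLocal
                  (labelSucc c.1) c.2)) (i, vQ))) : ℝ) : WithTop ℝ) ≤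
      (settingPrVolSharp X hlog M archPk archSub Ψ act Mmod region n lat sig split qData tq t htq0 htq1).negLogTheta :=
  RHSlotReach.negLogQ_sub_le_negLogTheta_of_licenceOn
    ({ toSituation := situationPrVol X hlog M archPk archSub Ψ act Mmod region, col := col } : LatticeSituation (thetaIndex X))
    (settingPrVolSharp X hlog M archPk archSub Ψ act Mmod region n lat sig split qData tq t htq0 htq1) σ
    (bridgeHyps_settingPrVolSharp_of_ideles X hlog M archPk archSub Ψ act Mmod region n lat sig split qData t tq ht0 ht1 htq0 htq1) hon
    (offWindowDeficitLe_pilotGap_sub_mass X hlog M archPk archSub Ψ act Mmod region n lat sig split qData tq t htq0 htq1 ht0 ht1 ht htq col σ)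

end Bed

end Summit.ABC.IUTFork.Repair.RH.CellWeights

end
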